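import Mathlib
import Summits.Ventures.PercRepro.TriangleCapRowBands
import Summits.Ventures.PercRepro.TriangleCapSpectrumExact
import Summits.Ventures.PercRepro.TriangleCapBandEnds

/-!
# PercRepro — THE FIRST `T` LAYERS OF THE CHERRY TABLE OF EVERY ROW `a ≥ 3`, EXACT WITH THE TRUNCATED BANDS; AND
THE BAND BOUND ON `n` VERTICES (p3, gen 51; part 240)

`cherry_row_top_layers` (`3 ≤ a`, `4 T + 3 ≤ r`, `2 r ≥ 4 T + 6 + T (T + 1)`, `a + T < r`, `2 a + r ≤ k`,
`2 (T + 1)(r − T − 2) ≤ stabGapFull k a r`): a `K₄⁻`-free graph strictly within `2 (T + 1)(r − T − 2)` of the closed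
form sits at a band value `closed − (2 t (r − t − 1) + 2 j)` with `t ≤ T` and `j` in the TRUNCATED band of the row
(`2 j + 2 q t ≤ 2 t + t (t − 1) + (a − 1) q (q + 1)`, `q = ⌊t / (a − 1)⌋`), and every such value is attained — the
complete top of the cherry table of every row `a ≥ 3`, with no lower bound on `a` in terms of `T` (part 232 needed
`T + 1 ≤ a`).  `band_bound_vertices`: on `n` vertices a triangle-free graph with `s` edges at a band-`t` value has
`2 j + 2 q t ≤ t (t + 1) + (n − 1 − (s − t)) q (q + 1)` for every `q` — the off-edges each meet the `n − 1 − (s − t)`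
non-neighbours of the star centre at least once (no edge inside a neighbourhood).  Axioms: standard.
-/

namespace PercRepro

namespace TriangleCap

namespace C047

open Finset

variable {V : Type*} [Fintype V] [DecidableEq V]

/-- **THE FIRST `T` LAYERS OF THE CHERRY TABLE OF THE ROW `a`, EXACT** (`3 ≤ a`, `4 T + 3 ≤ r`,
`2 r ≥ 4 T + 6 + T (T + 1)`, `a + T < r`, `2 a + r ≤ k` (`r + 7 ≤ k` at `a = 3`), `2 (T + 1)(r − T − 2) ≤ stabGapFull`):
(i) a `K₄⁻`-free graph strictly within `2 (T + 1)(r − T − 2)` of the closed form sits at a band value with `t ≤ T`,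
`2 j ≤ t (t + 1)` and `2 j + 2 q t ≤ 2 t + t (t − 1) + (a − 1) q (q + 1)`, `q = ⌊t / (a − 1)⌋`; (ii) every such `(t, j)` is
attained. -/
theorem cherry_row_top_layers (k a r T : ℕ) (ha3 : 3 ≤ a) (hr4 : 4 * T + 3 ≤ r)
    (hr : 4 * T + 6 + T * (T + 1) ≤ 2 * r) (hat : a + T < r) (hk : 2 * a + r ≤ k) (hk3 : a = 3 → r + 7 ≤ k)
    (hgap : 2 * ((T + 1) * (r - T - 2)) ≤ stabGapFull k a r) :
    (∀ (D : SimpleGraph (Fin k)) [DecidableRel D.Adj], K4mFree D → D.edgeFinset.card + r = a * (k - a) →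
        D.edgeFinset.card * k < ∑ v, deg D v * deg D v + r * (k - 1 - r) + 2 * ((T + 1) * (r - T - 2)) →
        ∃ t, t ≤ T ∧ ∃ j, 2 * j ≤ t * (t + 1) ∧
          2 * j + 2 * (t / (a - 1)) * t ≤ 2 * t + t * (t - 1) + (a - 1) * ((t / (a - 1)) * (t / (a - 1) + 1)) ∧
          ∑ v, deg D v * deg D v + r * (k - 1 - r) + (2 * (t * (r - t - 1)) + 2 * j) = D.edgeFinset.card * k) ∧
      (∀ t, t ≤ T → ∀ j, 2 * j ≤ t * (t + 1) →
        2 * j + 2 * (t / (a - 1)) * t ≤ 2 * t + t * (t - 1) + (a - 1) * ((t / (a - 1)) * (t / (a - 1) + 1)) →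
        ∃ (D : SimpleGraph (Fin k)) (_ : DecidableRel D.Adj), K4mFree D ∧ D.edgeFinset.card + r = a * (k - a) ∧
          ∑ v, deg D v * deg D v + r * (k - 1 - r) + (2 * (t * (r - t - 1)) + 2 * j) =
            D.edgeFinset.card * k) := by
  have hcard : Fintype.card (Fin k) = k := Fintype.card_fin k
  refine ⟨?_, ?_⟩
  · intro D _ hK hm hlt
    -- the band (part 232, membership half, which needs no lower bound on `a`)
    have hbip : ∃ A : Finset (Fin k), A.card = a ∧ BipSub D A := by
      by_contra hnb
      have h := (stab_table_rows_ge_three k a r ha3 hk (by omega) hk3).1 D hK hm hnb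
      omega
    obtain ⟨A, hA, hB⟩ := hbip
    have hH := bipSub_sum_deg_sq_add_disjEdgePairs D A hB a r hA (by rw [hcard]; exact hm) (by rw [hcard]; omega)
    rw [hcard] at hH
    have hr' : (missingGraph D A).edgeFinset.card = r :=
      card_edges_missingGraph D A hB a r hA (by rw [hcard]; exact hm)
    have hid := sum_deg_sq_add_disjEdgePairs (missingGraph D A)
    rw [hr'] at hid
    have hfree := cliqueFree_of_bipSub _ A (bipSub_missingGraph D A)
    rcases pair_count_spectrum_level (missingGraph D A) hfree T r hr4 hr' with ⟨t, ht, j, hj, h⟩ | h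
    · refine ⟨t, ht, j, hj, ?_, by omega⟩
      rcases Nat.eq_zero_or_pos t with rfl | hpos
      · have : j = 0 := by omega
        subst this
        simp
      · have hlt' : 2 * (t * (r - t - 1)) + t * (t + 1) < stabGapFull k a r := by
          have := band_lt_tail r T t (t * (t + 1) / 2) ht hr (by omega)
          have h2 : 2 * (t * (t + 1) / 2) = t * (t + 1) := by
            obtain ⟨c, hc⟩ := Nat.even_mul_succ_self t
            omega
          omega
        exact cherry_row_band_bound k a r t ha3 hpos (by omega) (by nlinarith) (by omega) hk hk3 hlt' j hj D hK hm
          (by omega) (t / (a - 1))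
    · omega
  · intro t ht j hj hjq
    rcases Nat.eq_zero_or_pos t with rfl | hpos
    · have hj0 : j = 0 := by omega
      subst hj0
      have hK := k4mFree_bipMinusStar k a r
      have hE := card_edges_bipMinusStar k a r (by omega) (by omega)
      have hS := sum_deg_sq_bipMinusStar k a r (by omega) (by omega) (by omega)
      rw [hcard] at hS
      exact ⟨bipMinusStar k a r, inferInstance, hK, hE, by simpa using hS⟩
    · exact row_band_attained k a r t j (by omega) hpos (by omega) (by omega) (by omega) hjq

/-- The off-edges at `w` each meet the non-neighbourhood `V ∖ N[w]` at least once (no edge inside `N(w)` in a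
triangle-free graph). -/
theorem one_le_card_filter_nonneighbour (H : SimpleGraph V) [DecidableRel H.Adj] (hfree : H.CliqueFree 3) (w : V)
    (e : Sym2 V) (he : e ∈ offEdges H w) :
    1 ≤ ((univ.filter (fun v => ¬ H.Adj w v ∧ v ≠ w)).filter (fun x => x ∈ e)).card := by
  rw [mem_offEdges, SimpleGraph.mem_edgeFinset] at he
  obtain ⟨he, hwe⟩ := he
  revert he hwe
  refine Sym2.ind (fun x y he hwe => ?_) e
  rw [SimpleGraph.mem_edgeSet] at he
  rw [Sym2.mem_iff] at hwe
  rw [Nat.one_le_iff_ne_zero, Ne, card_eq_zero, ← Ne, ← nonempty_iff_ne_empty]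
  by_cases hx : H.Adj w x
  · -- then `y` is not a neighbour of `w`: `w x y` would be a triangle
    refine ⟨y, ?_⟩
    simp only [mem_filter, mem_univ, true_and, Sym2.mem_iff]
    refine ⟨⟨fun hy => ?_, fun h => hwe (Or.inr h.symm)⟩, Or.inr trivial⟩
    exact hfree {w, x, y} (SimpleGraph.is3Clique_triple_iff.mpr ⟨hx, hy, he⟩)
  · refine ⟨x, ?_⟩
    simp only [mem_filter, mem_univ, true_and, Sym2.mem_iff]
    exact ⟨⟨hx, fun h => hwe (Or.inl h.symm)⟩, Or.inl trivial⟩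

/-- The off-degrees over a set met at least once by every off-edge sum to at least the number of off-edges. -/
theorem card_le_sum_offDeg_of_meets (H : SimpleGraph V) [DecidableRel H.Adj] (w : V) (L : Finset V)
    (hL : ∀ e ∈ offEdges H w, 1 ≤ (L.filter (fun x => x ∈ e)).card) :
    (offEdges H w).card ≤ ∑ x ∈ L, offDeg H w x := by
  unfold offDeg
  simp_rw [card_filter]
  rw [sum_comm, card_eq_sum_ones]
  apply sum_le_sum
  intro e he
  have := hL e he
  rw [card_filter] at this
  exact this

/-- **THE BAND BOUND ON `n` VERTICES:** a triangle-free graph on `n` vertices with `s` edges at a band-`t` value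
`Σ d² + 2 t (s − t − 1) + 2 j = s (s + 1)` at a vertex `w` of degree `s − t ≥ 1` has
`2 j + 2 q t ≤ t (t + 1) + (n − 1 − (s − t)) q (q + 1)` for every `q`. -/
theorem band_bound_vertices (H : SimpleGraph V) [DecidableRel H.Adj] (hfree : H.CliqueFree 3) (s t j : ℕ)
    (hm : H.edgeFinset.card = s) (w : V) (hw : 1 ≤ deg H w) (ht : (offEdges H w).card = t)
    (hS : ∑ v, deg H v * deg H v + 2 * (t * (s - t - 1)) + 2 * j = s * (s + 1)) (q : ℕ) :
    2 * j + 2 * q * t ≤ t * (t + 1) + (Fintype.card V - 1 - (s - t)) * (q * (q + 1)) := by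
  set L := univ.filter (fun v => ¬ H.Adj w v ∧ v ≠ w) with hLdef
  have hwL : w ∉ L := by simp [hLdef]
  have hLcard : L.card = Fintype.card V - 1 - (s - t) := by
    have hcard := card_offEdges_add_deg H w
    rw [ht, hm] at hcard
    have h1 : L.card + (univ.filter (fun v => H.Adj w v)).card + 1 = Fintype.card V := by
      have hsplit := card_filter_add_card_filter_not (s := (univ : Finset V)) (fun v => H.Adj w v)
      rw [card_univ] at hsplit
      have h2 : (univ.filter (fun v => ¬ H.Adj w v)).card = L.card + 1 := by
        have : univ.filter (fun v => ¬ H.Adj w v) = insert w L := by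
          ext v
          simp only [hLdef, mem_filter, mem_univ, true_and, mem_insert]
          constructor
          · intro h
            by_cases hv : v = w
            · exact Or.inl hv
            · exact Or.inr ⟨h, hv⟩
          · rintro (rfl | ⟨h, -⟩)
            · exact H.irrefl
            · exact h
        rw [this, card_insert_of_notMem hwL]
      omega
    unfold deg at hcard
    omega
  have hsum := card_le_sum_offDeg_of_meets H w L (fun e he => one_le_card_filter_nonneighbour H hfree w e he)
  rw [ht] at hsum
  have hP := sum_offDeg_mul_pred_le H w L hwL
  have htan : ∀ x ∈ L, 2 * q * offDeg H w x ≤ offDeg H w x * (offDeg H w x - 1) + q * (q + 1) :=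
    fun x _ => two_mul_le_mul_pred_add _ q
  have hsum2 := sum_le_sum htan
  rw [sum_add_distrib, sum_const, smul_eq_mul, ← mul_sum] at hsum2
  have hkey := (layer_value_iff H s t j hm w hw ht).mp hS
  rw [← hLcard]
  nlinarith

end C047

end TriangleCap

end PercRepro
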